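import Mathlib.Topology.Maps.Proper.CompactlyGenerated
import Literature.Geometry.Lorentzian.AsymptoticFlatness
import Literature.Geometry.Lorentzian.TrappedSurface
import HarnessLib

/-!
# Inverse mean curvature flow I: Hawking mass, classical flow, level-set weak formulation
(family `gr`, in support of **gr.S09** `riemannian_penrose_inequality_connected` of
`MassInequalities.lean`; trunk G08 = T-LORENTZ; namespace `Literature.GR`)

Huisken–Ilmanen (J. Differential Geom. 59 (2001)) prove the Riemannian Penrose inequality
`m ≥ √(|N|/16π)` by the monotonicity of Geroch's Hawking mass `m_H` along a *weak* (level-set)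
inverse mean curvature flow (IMCF). The named fact `riemannian_penrose_inequality_connected`
vendors their Main Theorem; its proof is a theory (weak existence by elliptic regularisation and
geometric measure theory, §§1–3; exterior regions, §4; Geroch monotonicity through jumps, §§5–6;
ADM asymptotics, §7; assembly, §8), decomposed bottom-up into named facts. This first file
vendors the objects of §0–§1 and §3 that are expressible with the Lorentz prelude:

* `hawkingMass h f ν hpb hf` — the Hawking mass `√(|N|/16π) (1 - (16π)⁻¹ ∫_N H²)` of a compact
  surface immersed in a Riemannian `3`-manifold (real definition), with
  `hawkingMass_eq_sqrt_mul` (Huisken–Ilmanen's form `|N|^{1/2}(16π - ∫H²)/(16π)^{3/2}`),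
  `hawkingMass_le_sqrt` (`m_H ≤ √(|N|/16π)`), `hawkingMass_of_isMaximalSlice` (for a minimal
  surface `m_H = √(|N|/16π)` — the identity with which §8 starts) and `hawkingMass_outermostMOTS`
  (for `S : OutermostMOTS (𝓡 3) h 0`, `m_H(S) = √(S.surfaceArea/16π)`, the left-hand side of
  gr.S09), all proved;
* `IsClassicalIMCF h hpb F ν a b` — classical solutions `∂F/∂t = ν/H`, `H > 0` of (∗) (real
  definition), and the named facts `area_exp_classical` ((1.1): `|N_t| = e^{t-s}|N_s|`) and
  `geroch_monotonicity_smooth` (§5 "Monotonicity Calculation": for connected closed `N_t` and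
  `R ≥ 0`, `t ↦ m_H(N_t)` is nondecreasing — Geroch 1973, Jang–Wald 1977);
* the level-set weak formulation of §1: `gradNorm` (`|∇u|_h`), `IsLocLipschitzOn` (locally
  Lipschitz for the Riemannian distance), `imcfEnergy` (`J_u^K(v) = ∫_K |∇v| + v|∇u|`),
  `IsCompetitor` (`{v ≠ u} ⊂⊂ Ω`), `IsWeakSolution`/`IsWeakSubsolution`/`IsWeakSupersolution`
  ((1.5)), `IsWeakSolutionIVP`/`IsWeakSubsolutionIVP` ((††)), `IsProperFun` (with
  `isProperFun_iff_isProperMap`: for continuous `u` this is Mathlib's `IsProperMap`, proved),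
  `IsSmoothPrecompactOpen` (all real definitions), and the named fact `weak_existence`
  (Thm. 3.1, for noncompact `3`-manifolds, without the gradient estimate (3.1)).

Not yet vendored (next files of the decomposition, see the `NOTES.md` of the fact): weak mean
curvature of `C¹` surfaces via the first variation formula (1.11)–(1.12) and the Hawking mass of
the `C^{1,α}` level sets `N_t = ∂{u < t}`; the H²-growth and Geroch Monotonicity Formulas 5.7–5.8;
Thm. 6.1 (multiple boundary components); the Asymptotic Comparison Lemma 7.4
(`lim m_H(N_t) ≤ m_ADM`); Lemma 4.1 (exterior regions) and the reduction of a connected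
`OutermostMOTS` with `IsExteriorRegion` to a boundary sphere of Huisken–Ilmanen's exterior region.

## Mathlib

Mathlib (at the pin) has no mean curvature flows, Hawking mass or level-set formulations
(`rg -i 'mean curvature flow|Hawking mass|level.set' Mathlib` finds nothing relevant). Used:
`mfderiv` (time derivatives `mfderiv 𝓘(ℝ, ℝ) (𝓡 3) (s ↦ F s y) t 1` and differentials
`mfderiv (𝓡 3) 𝓘(ℝ, ℝ) u x`), `ContMDiffOn` on `(a, b) × S` for the model `𝓘(ℝ, ℝ).prod (𝓡 2)`,
`TangentBundle`/`TotalSpace.mk'` (smoothness of normal fields), `LocallyLipschitzOn` for the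
Riemannian length pseudo-emetric `PseudoEMetricSpace.ofRiemannianMetric` (whose topology is the
manifold topology; it needs `RegularSpace X`, obtained from `[T2Space X] [LocallyCompactSpace X]`),
the Bochner integral, `Manifold.IsSmoothEmbedding`, `Real.sqrt`; and the Lorentz prelude:
`meanCurvature`, `IsMaximalSlice`, `IsSpacelikeImmersion`, `IsUnitNormal`, `NormalField`,
`inducedRiemannianMetric`, `contMDiff_pullbackBilin` (`Hypersurface`, `Isometry`), `innerDual`,
`scalarCurvature`, `HasLeviCivita`, `leviCivita`, `IsGeodesicallyComplete` (`PseudoRiemannianMetric`,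
`LeviCivita`, `Geodesic`), `totalArea`, `riemannianVolume`, `riemannianMeasure` (`Volume`), `E3`.

## Design choices

* *Dimension three, fixed models.* Everything is stated for `3`-manifolds `X` modelled on `E3`
  and surfaces modelled on `EuclideanSpace ℝ (Fin 2)`, the setting of `MassInequalities.lean`
  (Huisken–Ilmanen's existence theory is dimension-free; the `n = 3` statements are
  specialisations, hence weaker than the printed theorems).
* *Hawking mass.* Defined in the factored form `√(|N|/16π)(1 - (16π)⁻¹∫H²)` (the pattern of the
  spacetime `LorentzianMetric.hawkingMass` of `BondiMass.lean`, to which it reduces for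
  time-symmetric slices, `θ_L θ_L̲ = -H²`) and proved equal to Huisken–Ilmanen's expression. Only
  `H²` enters, so the choice of unit normal is immaterial. Area and measure are those of
  `Volume.lean` (`μHE[2]` of the induced length metric, which for smooth compact surfaces is the
  Riemannian area, Federer 3.2.46), exactly as `OutermostMOTS.surfaceArea`; thus for a smooth
  minimal horizon `S`, `hawkingMass = √(surfaceArea/16π)` is `hawkingMass_outermostMOTS`.
* *Classical flows as a `Prop`-valued structure* on `(F, ν)` indexed by all `t : ℝ` with
  conditions on the open interval `(a, b)` (no values at the endpoints are constrained; smoothness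
  up to `t = 0` is not needed for the monotonicity statements). The unit normal is part of the
  data and is required to be smooth into `TX`, so that `meanCurvature` (which differentiates `ν`)
  takes no junk values; `H > 0` w.r.t. `ν` fixes its sign. The literal equation `∂F/∂t = H⁻¹ ν`
  (normal parametrisation) is imposed, as printed in (∗).
* *Weak formulation.* `|∇u|` is `√(h⁻¹(du, du))` with `du = mfderiv`, junk `0` off the
  differentiability set — a null set for locally Lipschitz `u` (Rademacher), so `J_u^K` is the
  printed integral. Local Lipschitz continuity is taken w.r.t. the Riemannian distance (Mathlib's
  length metric of `h`), equivalently in charts. In (1.5) the compact set `K ⊆ Ω` is universally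
  quantified over all compact `K ⊇ {u ≠ v}` ("it does not matter which such set we use",
  Huisken–Ilmanen after (1.5)). Competitors are functions on `X` constrained only on `Ω`.
  The initial value problem (††) is posed on `Ω = X ∖ Ē₀` (so that `{v ≠ u} ⊂⊂ Ω` keeps
  competitors off `∂E₀`; cf. the remark before Lemma 1.2 and `Ω := M ∖ Ē₀` in the proof of
  Lemma 4.2). "Smooth open set" is made precise as: open, regular open
  (`interior (closure E₀) = E₀`, which puts `E₀` locally on one side of its boundary) with
  boundary the image of a smooth embedding of a compact surface.
* *Instance hypotheses.* Facts quantify over `X : Type` with `[T2Space X]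
  [SecondCountableTopology X]` as in `MassInequalities.lean`, plus `[LocallyCompactSpace X]`
  (true for every finite-dimensional manifold, `Manifold.locallyCompact_of_finiteDimensional`,
  but not an instance; it yields `RegularSpace`/`T3Space X` for the length metric and the
  Riemannian measure) and `[MeasurableSpace X] [BorelSpace X]` where integrals over `X` occur
  (users take `borel X`).

## References

* G. Huisken, T. Ilmanen, *The inverse mean curvature flow and the Riemannian Penrose
  inequality*, J. Differential Geom. 59 (2001) 353–437: §0 ((∗), (∗∗), (0.1)–(0.3), Main Theorem,
  "The Proof"), §1 (Definition (1.5), (††), (†), (1.1)–(1.3), (1.11)–(1.12)), §3 Thm. 3.1 and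
  Remark 1, §5 (Monotonicity Calculation; 5.7, 5.8), §6 Thm. 6.1, §7 Lemma 7.4, §8.
* R. Geroch, *Energy extraction*, Ann. New York Acad. Sci. 224 (1973) 108–117 (monotonicity of
  the Hawking mass under smooth IMCF).
* P. S. Jang, R. M. Wald, *The positive energy conjecture and the cosmic censor hypothesis*,
  J. Math. Phys. 18 (1977) 41–44.
* S. W. Hawking, *Gravitational radiation in an expanding universe*, J. Math. Phys. 9 (1968)
  598–604 (the Hawking mass).
-/

noncomputable section

open Bundle Set Manifold TopologicalSpace Filter MeasureTheory
open scoped ContDiff Topology ENNReal Manifold Real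

namespace Literature.Geometry.Lorentzian

open PseudoRiemannianMetric

variable {X : Type*} [TopologicalSpace X] [ChartedSpace E3 X] [IsManifold (𝓡 3) ∞ X]

/-! ### The Hawking mass of a closed surface in a Riemannian `3`-manifold -/

section HawkingMass

variable (h : ContMDiffRiemannianMetric (𝓡 3) ∞ E3 (TangentSpace (𝓡 3) : X → Type _))
  [(ofRiemannian h).HasLeviCivita]
  {S : Type*} [TopologicalSpace S] [ChartedSpace (EuclideanSpace ℝ (Fin 2)) S]
  [IsManifold (𝓡 2) ∞ S] [CompactSpace S] [T2Space S] [MeasurableSpace S] [BorelSpace S]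

/-- The **Hawking (quasi-local) mass** of the compact surface `f : S → X` immersed in the
Riemannian `3`-manifold `(X, h)`, with respect to the field `ν` along `f` (meant: a unit normal):
`m_H(N) = √(|N| / 16π) · (1 - (16π)⁻¹ ∫_N H² dμ)`, which is Huisken–Ilmanen's
`|N|^{1/2} (16π - ∫_N H²) / (16π)^{3/2}` (`hawkingMass_eq_sqrt_mul`); here `|N| = totalArea (f^* h)`
and `dμ = riemannianVolume (f^* h) 2` are the area and the area measure of the induced metric
(`Volume.lean`) and `H = meanCurvature` (`Hypersurface.lean`; only `H²` enters, so the sign of `ν`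
is immaterial). Junk values: `toReal` of an infinite area (none for compact `S`,
`riemannianVolume_lt_top_of_isCompact`) and the Bochner integral `0` of a non-integrable `H²`.
For a round sphere in `ℝ³`, `∫ H² = 16π` and `m_H = 0`; for the horizon of Schwarzschild of mass
`m`, `H = 0` and `m_H = √(|N|/16π) = m`. Huisken–Ilmanen, J. Differential Geom. 59 (2001), §0
("The Proof") and §5 (definition of `m_H` recalled before the Monotonicity Calculation); Geroch
1973. [cite: HuiskenIlmanenIMCF2001, §0 and §5 (definition of m_H)] -/
def hawkingMass (f : S → X) (ν : NormalField (𝓡 3) f)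
    (hpb : contMDiff_pullbackBilin (𝓡 3) X (𝓡 2) S ∞)
    (hf : (ofRiemannian h).IsSpacelikeImmersion (𝓡 2) f) : ℝ :=
  Real.sqrt ((totalArea ((ofRiemannian h).inducedRiemannianMetric f hpb hf)).toReal / (16 * π)) *
    (1 - (16 * π)⁻¹ *
      ∫ y, (ofRiemannian h).meanCurvature f hpb hf ν y ^ 2
        ∂(riemannianVolume ((ofRiemannian h).inducedRiemannianMetric f hpb hf) 2))

/-- The Hawking mass in Huisken–Ilmanen's form `m_H(N) = |N|^{1/2} (16π - ∫_N H²) / (16π)^{3/2}`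
(with `(16π)^{3/2} = 16π · √(16π)`). Huisken–Ilmanen 2001, §5.
[cite: HuiskenIlmanenIMCF2001, §5 (definition of m_H)] -/
theorem hawkingMass_eq_sqrt_mul (f : S → X) (ν : NormalField (𝓡 3) f)
    (hpb : contMDiff_pullbackBilin (𝓡 3) X (𝓡 2) S ∞)
    (hf : (ofRiemannian h).IsSpacelikeImmersion (𝓡 2) f) :
    hawkingMass h f ν hpb hf =
      Real.sqrt (totalArea ((ofRiemannian h).inducedRiemannianMetric f hpb hf)).toReal *
        (16 * π - ∫ y, (ofRiemannian h).meanCurvature f hpb hf ν y ^ 2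
          ∂(riemannianVolume ((ofRiemannian h).inducedRiemannianMetric f hpb hf) 2)) /
        (16 * π * Real.sqrt (16 * π)) := by
  have hπ : 0 < 16 * π := by positivity
  have hs : Real.sqrt (16 * π) ≠ 0 := (Real.sqrt_pos.2 hπ).ne'
  rw [hawkingMass, Real.sqrt_div ENNReal.toReal_nonneg]
  field_simp

/-- The Hawking mass never exceeds `√(|N|/16π)` (since `∫ H² ≥ 0`). Huisken–Ilmanen 2001, §0.
[cite: HuiskenIlmanenIMCF2001, §0] -/
theorem hawkingMass_le_sqrt (f : S → X) (ν : NormalField (𝓡 3) f)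
    (hpb : contMDiff_pullbackBilin (𝓡 3) X (𝓡 2) S ∞)
    (hf : (ofRiemannian h).IsSpacelikeImmersion (𝓡 2) f) :
    hawkingMass h f ν hpb hf ≤
      Real.sqrt ((totalArea ((ofRiemannian h).inducedRiemannianMetric f hpb hf)).toReal /
        (16 * π)) := by
  rw [hawkingMass]
  refine mul_le_of_le_one_right (Real.sqrt_nonneg _) ?_
  have hI : 0 ≤ ∫ y, (ofRiemannian h).meanCurvature f hpb hf ν y ^ 2
      ∂(riemannianVolume ((ofRiemannian h).inducedRiemannianMetric f hpb hf) 2) :=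
    integral_nonneg fun _ ↦ sq_nonneg _
  have hπ : 0 < 16 * π := by positivity
  nlinarith [mul_nonneg (inv_nonneg.2 hπ.le) hI]

/-- **The Hawking mass of a minimal surface** is `√(|N|/16π)`: if `H = 0` on `N`
(`IsMaximalSlice`, i.e. `N` is a minimal surface) then `∫ H² = 0`. This is the identity
`m_H(N₀) = √(|N|/16π)` for the horizon with which the proof of the Main Theorem starts.
Huisken–Ilmanen 2001, §0 ("Since `H = 0` on the inner boundary …") and §8, proof of the Main
Theorem, step 1. [cite: HuiskenIlmanenIMCF2001, §8 proof of Main Theorem step 1] -/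
theorem hawkingMass_of_isMaximalSlice (f : S → X) (ν : NormalField (𝓡 3) f)
    (hpb : contMDiff_pullbackBilin (𝓡 3) X (𝓡 2) S ∞)
    (hf : (ofRiemannian h).IsSpacelikeImmersion (𝓡 2) f)
    (hmin : (ofRiemannian h).IsMaximalSlice f hpb hf ν) :
    hawkingMass h f ν hpb hf =
      Real.sqrt ((totalArea ((ofRiemannian h).inducedRiemannianMetric f hpb hf)).toReal /
        (16 * π)) := by
  have h0 : (fun y ↦ (ofRiemannian h).meanCurvature f hpb hf ν y ^ 2) = fun _ ↦ 0 :=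
    funext fun y ↦ by simp [hmin y]
  simp [hawkingMass, h0]

/-- **The Hawking mass of an outermost minimal surface is `√(|S|/16π)`**, the left-hand side of
the Riemannian Penrose inequality (`riemannian_penrose_inequality_connected` of
`MassInequalities.lean`): an `OutermostMOTS` of time-symmetric data (`k = 0`) is a minimal
surface (`isMOTSInData_zero_iff`), and `|S| = S.surfaceArea` is the total area of its induced
metric. Huisken–Ilmanen 2001, §8, proof of the Main Theorem, step 1 (`N_0 = N`, `H = 0`).
[cite: HuiskenIlmanenIMCF2001, §8 proof of Main Theorem step 1] -/
theorem hawkingMass_outermostMOTS (S : OutermostMOTS (𝓡 3) h 0) :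
    hawkingMass h S.f S.ν S.hpb S.isSpacelikeImmersion =
      Real.sqrt (S.surfaceArea.toReal / (16 * π)) :=
  hawkingMass_of_isMaximalSlice h S.f S.ν S.hpb S.isSpacelikeImmersion
    ((isMOTSInData_zero_iff h S.f S.hpb S.isSpacelikeImmersion S.ν).1 S.isMOTS)

end HawkingMass

/-! ### Classical solutions of the flow and Geroch monotonicity (smooth case) -/

section Classical

variable (h : ContMDiffRiemannianMetric (𝓡 3) ∞ E3 (TangentSpace (𝓡 3) : X → Type _))
  [(ofRiemannian h).HasLeviCivita]
  {S : Type*} [TopologicalSpace S] [ChartedSpace (EuclideanSpace ℝ (Fin 2)) S]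
  [IsManifold (𝓡 2) ∞ S]

/-- A **classical solution of the inverse mean curvature flow** in the Riemannian `3`-manifold
`(X, h)` on the open time interval `(a, b)`: a family of maps `F t : S → X` of a fixed surface `S`,
jointly smooth in `(t, y)` on `(a, b) × S`, each `F t` a (spacelike, i.e. Riemannian) immersion
with a smooth unit normal field `ν t` along it, of *positive* mean curvature `H > 0` with respect
to `ν t`, moving with normal velocity `∂F/∂t = ν / H` (Huisken–Ilmanen's (∗):
`∂x/∂t = ν / H`, `H > 0`). The time derivative is `mfderiv` of `s ↦ F s y` applied to
`1 ∈ T_t ℝ = ℝ`; the mean curvature is `meanCurvature` of `Hypersurface.lean` (sign convention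
`H = + div ν`, so for expanding round spheres in `ℝ³` with the outward normal `H = 2/r > 0` and
`r(t) = e^{t/2}`); `hpb` is the pullback-smoothness fact needed to state it. Smoothness of `ν t`
is smoothness of `y ↦ (F t y, ν t y)` into the tangent bundle. Huisken–Ilmanen,
J. Differential Geom. 59 (2001), introduction, (∗). [cite: HuiskenIlmanenIMCF2001, §0 (∗)] -/
structure IsClassicalIMCF (hpb : contMDiff_pullbackBilin (𝓡 3) X (𝓡 2) S ∞)
    (F : ℝ → S → X) (ν : (t : ℝ) → NormalField (𝓡 3) (F t)) (a b : ℝ) : Prop where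
  /-- The family is jointly smooth on `(a, b) × S`. -/
  contMDiffOn : ContMDiffOn (𝓘(ℝ, ℝ).prod (𝓡 2)) (𝓡 3) ∞ (fun p : ℝ × S ↦ F p.1 p.2)
    (Set.Ioo a b ×ˢ univ)
  /-- Each `F t` is a spacelike (Riemannian) immersion. -/
  isSpacelikeImmersion : ∀ t ∈ Set.Ioo a b, (ofRiemannian h).IsSpacelikeImmersion (𝓡 2) (F t)
  /-- Each `ν t` is a unit normal along `F t`. -/
  isUnitNormal : ∀ t ∈ Set.Ioo a b, (ofRiemannian h).IsUnitNormal (𝓡 2) (F t) (ν t) 1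
  /-- Each `ν t` is smooth as a map into the tangent bundle. -/
  contMDiff_normal : ∀ t ∈ Set.Ioo a b, ContMDiff (𝓡 2) (𝓡 3).tangent ∞
    fun y ↦ (TotalSpace.mk' E3 (F t y) (ν t y) : TangentBundle (𝓡 3) X)
  /-- The mean curvature with respect to `ν t` is positive. -/
  meanCurvature_pos : ∀ t (ht : t ∈ Set.Ioo a b) (y : S),
    0 < (ofRiemannian h).meanCurvature (F t) hpb (isSpacelikeImmersion t ht) (ν t) y
  /-- The flow equation `∂F/∂t = H⁻¹ ν`. -/
  velocity_eq : ∀ t (ht : t ∈ Set.Ioo a b) (y : S),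
    mfderiv 𝓘(ℝ, ℝ) (𝓡 3) (fun s ↦ F s y) t 1 =
      ((ofRiemannian h).meanCurvature (F t) hpb (isSpacelikeImmersion t ht) (ν t) y)⁻¹ • ν t y

end Classical

/-- **Exponential growth of area under the classical flow.** Named fact: Huisken–Ilmanen,
J. Differential Geom. 59 (2001), §1, (1.1) and the display following it: *for a smooth family
`(N_t)` solving (∗), the first variation formula gives `∂_t dμ_t = H v dμ_t = dμ_t` (normal speed
`v = 1/H`), hence `d/dt |N_t| = |N_t|` and `|N_t| = e^t |N_0|`.* Hypotheses: a classical solution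
`IsClassicalIMCF h hpb F ν a b` of a compact surface `S` (closed, so no boundary terms).
Conclusion: `|N_t| = e^{t-s} |N_s|` for `s, t ∈ (a, b)`, areas being `totalArea` of the induced
metrics (in `ℝ≥0∞`). [cite: HuiskenIlmanenIMCF2001, §1 (1.1)] -/
def area_exp_classical : Prop :=
  ∀ (X : Type) [TopologicalSpace X] [ChartedSpace E3 X] [IsManifold (𝓡 3) ∞ X] [T2Space X]
    [SecondCountableTopology X]
    (h : ContMDiffRiemannianMetric (𝓡 3) ∞ E3 (TangentSpace (𝓡 3) : X → Type _))
    [(ofRiemannian h).HasLeviCivita]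
    (S : Type) [TopologicalSpace S] [ChartedSpace (EuclideanSpace ℝ (Fin 2)) S]
    [IsManifold (𝓡 2) ∞ S] [CompactSpace S] [T2Space S] [MeasurableSpace S] [BorelSpace S]
    (hpb : contMDiff_pullbackBilin (𝓡 3) X (𝓡 2) S ∞)
    (F : ℝ → S → X) (ν : (t : ℝ) → NormalField (𝓡 3) (F t)) (a b : ℝ)
    (H : IsClassicalIMCF h hpb F ν a b),
    ∀ ⦃s t : ℝ⦄ (hs : s ∈ Set.Ioo a b) (ht : t ∈ Set.Ioo a b),
      totalArea ((ofRiemannian h).inducedRiemannianMetric (F t) hpb (H.isSpacelikeImmersion t ht)) =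
        ENNReal.ofReal (Real.exp (t - s)) *
          totalArea ((ofRiemannian h).inducedRiemannianMetric (F s) hpb
            (H.isSpacelikeImmersion s hs))

/-- **Geroch monotonicity, smooth case.** Named fact: Huisken–Ilmanen, J. Differential Geom. 59
(2001), §5, "Monotonicity Calculation" (the computation going back to Geroch 1973 and
Jang–Wald 1977): *for a smooth solution `(N_t)` of the inverse mean curvature flow (∗) by closed
surfaces in a Riemannian `3`-manifold, (1.1) and (1.3) together with the Gauss equation and the
Gauss–Bonnet formula give `d/dt ∫_{N_t} H² ≤ ½ (16π - ∫_{N_t} H²)`, provided that `N_t` is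
connected and `R ≥ 0`; since `|N_t| = e^t |N_0|`, this shows that `m_H(N_t)` is nondecreasing.*
Hypotheses: a classical solution `IsClassicalIMCF h hpb F ν a b` of a compact connected surface
`S` (closed: `S` is a manifold without boundary), and `R(h) ≥ 0` on all of `X` (stronger than
`R ≥ 0` along the flow). Conclusion: `s ≤ t` in `(a, b)` implies `m_H(N_s) ≤ m_H(N_t)`
(`hawkingMass`). [cite: HuiskenIlmanenIMCF2001, §5 Monotonicity Calculation (smooth case)] -/
def geroch_monotonicity_smooth : Prop :=
  ∀ (X : Type) [TopologicalSpace X] [ChartedSpace E3 X] [IsManifold (𝓡 3) ∞ X] [T2Space X]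
    [SecondCountableTopology X]
    (h : ContMDiffRiemannianMetric (𝓡 3) ∞ E3 (TangentSpace (𝓡 3) : X → Type _))
    [(ofRiemannian h).HasLeviCivita]
    (S : Type) [TopologicalSpace S] [ChartedSpace (EuclideanSpace ℝ (Fin 2)) S]
    [IsManifold (𝓡 2) ∞ S] [CompactSpace S] [T2Space S] [ConnectedSpace S]
    [MeasurableSpace S] [BorelSpace S]
    (hpb : contMDiff_pullbackBilin (𝓡 3) X (𝓡 2) S ∞)
    (F : ℝ → S → X) (ν : (t : ℝ) → NormalField (𝓡 3) (F t)) (a b : ℝ)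
    (H : IsClassicalIMCF h hpb F ν a b),
    (∀ x : X, 0 ≤ (ofRiemannian h).scalarCurvature x) →
    ∀ ⦃s t : ℝ⦄ (hs : s ∈ Set.Ioo a b) (ht : t ∈ Set.Ioo a b), s ≤ t →
      hawkingMass h (F s) (ν s) hpb (H.isSpacelikeImmersion s hs) ≤
        hawkingMass h (F t) (ν t) hpb (H.isSpacelikeImmersion t ht)

/-! ### The level-set (variational) weak formulation -/

section Weak

variable (h : ContMDiffRiemannianMetric (𝓡 3) ∞ E3 (TangentSpace (𝓡 3) : X → Type _))

/-- The **slope** `|∇u|_h (x) = √(h⁻¹(du_x, du_x))` of a real function on the Riemannian manifold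
`(X, h)`: the `h`-norm of the differential `du_x = mfderiv u x` (via the inverse metric
`innerDual` of `PseudoRiemannianMetric.lean`). Junk value `0` where `u` is not differentiable; for
a locally Lipschitz `u` this is a null set (Rademacher), so integrals of `|∇u|` are the honest
ones. Huisken–Ilmanen 2001, §1 (`|∇u|` in (∗∗) and (1.5)). [cite: HuiskenIlmanenIMCF2001, §1 (1.5)] -/
def gradNorm (u : X → ℝ) (x : X) : ℝ :=
  Real.sqrt ((ofRiemannian h).innerDual x
    (mfderiv (𝓡 3) 𝓘(ℝ, ℝ) u x).toLinearMap (mfderiv (𝓡 3) 𝓘(ℝ, ℝ) u x).toLinearMap)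

/-- The slope is nonnegative. [folklore] -/
lemma gradNorm_nonneg (u : X → ℝ) (x : X) : 0 ≤ gradNorm h u x :=
  Real.sqrt_nonneg _

/-- The slope of a constant function vanishes (`d(const) = 0`). [folklore] -/
@[simp]
lemma gradNorm_const (c : ℝ) (x : X) : gradNorm h (fun _ ↦ c) x = 0 := by
  simp only [gradNorm, mfderiv_const, PseudoRiemannianMetric.innerDual]
  exact Real.sqrt_zero

variable [T2Space X] [LocallyCompactSpace X]

/-- `u` is **locally Lipschitz on `Ω`** with respect to the Riemannian distance of `(X, h)`
(Mathlib's `LocallyLipschitzOn` for the length (pseudo-e)metric `PseudoEMetricSpace.ofRiemannianMetric`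
of `h`, whose topology is the manifold topology; equivalently, Lipschitz in charts near every point
of `Ω`). Huisken–Ilmanen 2001, §1 ("Let `u` be a locally Lipschitz function on the open set `Ω`").
[cite: HuiskenIlmanenIMCF2001, §1 Definition before (1.5)] -/
def IsLocLipschitzOn (u : X → ℝ) (Ω : Set X) : Prop :=
  letI : RiemannianBundle (fun x : X ↦ TangentSpace (𝓡 3) x) :=
    ⟨h.toContinuousRiemannianMetric.toRiemannianMetric⟩
  letI : PseudoEMetricSpace X := .ofRiemannianMetric (𝓡 3) X
  LocallyLipschitzOn Ω u

/-- Constant functions are locally Lipschitz (for the Riemannian distance, as for any distance).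
[folklore] -/
lemma isLocLipschitzOn_const (c : ℝ) (Ω : Set X) : IsLocLipschitzOn h (fun _ ↦ c) Ω := by
  letI : RiemannianBundle (fun x : X ↦ TangentSpace (𝓡 3) x) :=
    ⟨h.toContinuousRiemannianMetric.toRiemannianMetric⟩
  letI : PseudoEMetricSpace X := .ofRiemannianMetric (𝓡 3) X
  exact ((LipschitzWith.const c).locallyLipschitz).locallyLipschitzOn (s := Ω)

variable [MeasurableSpace X] [BorelSpace X]

/-- Huisken–Ilmanen's functional **`J_u^K(v) = ∫_K (|∇v| + v |∇u|) dx`** (freezing `|∇u|`),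
whose minimisation encodes the level-set equation (∗∗) `div(∇u/|∇u|) = |∇u|`; `dx` is the
Riemannian measure of `(X, h)` (`riemannianMeasure`, `Volume.lean`). Bochner integral (junk `0`
if not integrable; for `K` compact and `u`, `v` locally Lipschitz the integrand is bounded and
measurable). Huisken–Ilmanen 2001, §1, display before (1.5). [cite: HuiskenIlmanenIMCF2001, §1 (1.5)] -/
def imcfEnergy (u : X → ℝ) (K : Set X) (v : X → ℝ) : ℝ :=
  ∫ x in K, (gradNorm h v x + v x * gradNorm h u x) ∂(riemannianMeasure h)

/-- An admissible **competitor** for `u` on `Ω` in (1.5): a function `v`, locally Lipschitz on `Ω`,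
with `{v ≠ u} ⊂⊂ Ω` (the set where `v` and `u` differ on `Ω` lies in a compact subset of `Ω`).
Huisken–Ilmanen 2001, §1, (1.5). [cite: HuiskenIlmanenIMCF2001, §1 (1.5)] -/
def IsCompetitor (u : X → ℝ) (Ω : Set X) (v : X → ℝ) : Prop :=
  IsLocLipschitzOn h v Ω ∧ ∃ C, IsCompact C ∧ C ⊆ Ω ∧ {x | x ∈ Ω ∧ v x ≠ u x} ⊆ C

/-- `u` is a **weak solution** of (∗∗) `div(∇u/|∇u|) = |∇u|` on the (open) set `Ω`
(Huisken–Ilmanen's Definition, (1.5)): `u` is locally Lipschitz on `Ω` and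
`J_u^K(u) ≤ J_u^K(v)` for every competitor `v` (`IsCompetitor`: locally Lipschitz, `{v ≠ u} ⊂⊂ Ω`)
and every compact `K ⊆ Ω` containing `{u ≠ v}` ("it does not matter which such set we use").
Huisken–Ilmanen 2001, §1, Definition and (1.5). [cite: HuiskenIlmanenIMCF2001, §1 Definition (1.5)] -/
def IsWeakSolution (u : X → ℝ) (Ω : Set X) : Prop :=
  IsLocLipschitzOn h u Ω ∧
    ∀ v, IsCompetitor h u Ω v → ∀ K, IsCompact K → K ⊆ Ω → {x | x ∈ Ω ∧ v x ≠ u x} ⊆ K →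
      imcfEnergy h u K u ≤ imcfEnergy h u K v

/-- `u` is a **weak subsolution** of (∗∗) on `Ω`: as `IsWeakSolution`, but only against
competitors `v ≤ u` on `Ω`. Huisken–Ilmanen 2001, §1, Definition and (1.5).
[cite: HuiskenIlmanenIMCF2001, §1 Definition (1.5)] -/
def IsWeakSubsolution (u : X → ℝ) (Ω : Set X) : Prop :=
  IsLocLipschitzOn h u Ω ∧
    ∀ v, IsCompetitor h u Ω v → (∀ x ∈ Ω, v x ≤ u x) →
      ∀ K, IsCompact K → K ⊆ Ω → {x | x ∈ Ω ∧ v x ≠ u x} ⊆ K →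
        imcfEnergy h u K u ≤ imcfEnergy h u K v

/-- `u` is a **weak supersolution** of (∗∗) on `Ω`: as `IsWeakSolution`, but only against
competitors `v ≥ u` on `Ω`. Huisken–Ilmanen 2001, §1, Definition and (1.5).
[cite: HuiskenIlmanenIMCF2001, §1 Definition (1.5)] -/
def IsWeakSupersolution (u : X → ℝ) (Ω : Set X) : Prop :=
  IsLocLipschitzOn h u Ω ∧
    ∀ v, IsCompetitor h u Ω v → (∀ x ∈ Ω, u x ≤ v x) →
      ∀ K, IsCompact K → K ⊆ Ω → {x | x ∈ Ω ∧ v x ≠ u x} ⊆ K →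
        imcfEnergy h u K u ≤ imcfEnergy h u K v

/-- A weak solution is a weak subsolution (the easy half of Huisken–Ilmanen's remark that `u` is
a weak solution iff it is simultaneously a weak sub- and supersolution). Huisken–Ilmanen 2001, §1,
after (1.5). [cite: HuiskenIlmanenIMCF2001, §1 after (1.5)] -/
lemma IsWeakSolution.isWeakSubsolution {u : X → ℝ} {Ω : Set X} (hu : IsWeakSolution h u Ω) :
    IsWeakSubsolution h u Ω :=
  ⟨hu.1, fun v hv _ K hK hKΩ hvK ↦ hu.2 v hv K hK hKΩ hvK⟩

/-- A weak solution is a weak supersolution. Huisken–Ilmanen 2001, §1, after (1.5).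
[cite: HuiskenIlmanenIMCF2001, §1 after (1.5)] -/
lemma IsWeakSolution.isWeakSupersolution {u : X → ℝ} {Ω : Set X} (hu : IsWeakSolution h u Ω) :
    IsWeakSupersolution h u Ω :=
  ⟨hu.1, fun v hv _ K hK hKΩ hvK ↦ hu.2 v hv K hK hKΩ hvK⟩

/-- Constants are weak solutions on every `Ω` (unfolding check of the definitions):
`J_c^K(c) = ∫_K (0 + c · 0) = 0 ≤ ∫_K |∇v| = J_c^K(v)`. Under the flow the sets `{c < t}` jump
from `∅` to everything at `t = c`, the extreme case of "fattening". [folklore] -/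
lemma isWeakSolution_const (c : ℝ) (Ω : Set X) : IsWeakSolution h (fun _ ↦ c) Ω := by
  refine ⟨isLocLipschitzOn_const h c Ω, fun v _ K _ _ _ ↦ ?_⟩
  simp only [imcfEnergy, gradNorm_const, mul_zero, add_zero, integral_zero]
  exact integral_nonneg fun x ↦ gradNorm_nonneg h v x

/-- `u` is a **weak solution with initial condition `E₀`** (Huisken–Ilmanen's (††)):
`u ∈ C^{0,1}_loc(X)`, `E₀ = {u < 0}`, and `u` is a weak solution of (∗∗) on `X ∖ Ē₀` (this imposes
the Dirichlet condition `u = 0` on `∂E₀`). The evolving sets are `E_t = {u < t}`, the surfaces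
`N_t = ∂E_t`. Huisken–Ilmanen 2001, §1, "Initial Value Problem", (††).
[cite: HuiskenIlmanenIMCF2001, §1 (††)] -/
def IsWeakSolutionIVP (u : X → ℝ) (E₀ : Set X) : Prop :=
  IsLocLipschitzOn h u univ ∧ E₀ = {x | u x < 0} ∧ IsWeakSolution h u (closure E₀)ᶜ

/-- `u` is a **weak subsolution with initial condition `E₀`**: (††) with "weak solution" replaced
by "weak subsolution" (the object assumed to exist at infinity in the Weak Existence Theorem 3.1).
Huisken–Ilmanen 2001, §1 (††) and §3, Thm. 3.1. [cite: HuiskenIlmanenIMCF2001, §1 (††) and Thm. 3.1] -/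
def IsWeakSubsolutionIVP (u : X → ℝ) (E₀ : Set X) : Prop :=
  IsLocLipschitzOn h u univ ∧ E₀ = {x | u x < 0} ∧ IsWeakSubsolution h u (closure E₀)ᶜ

end Weak

section Domains

/-- `u : X → ℝ` is **proper** in Huisken–Ilmanen's sense: each set `{s ≤ u ≤ t}` is compact.
Huisken–Ilmanen 2001, §3 (before Thm. 3.1). [cite: HuiskenIlmanenIMCF2001, §3 before Thm. 3.1] -/
def IsProperFun (u : X → ℝ) : Prop :=
  ∀ s t : ℝ, IsCompact (u ⁻¹' Set.Icc s t)

omit [ChartedSpace E3 X] [IsManifold (𝓡 3) ∞ X] in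
/-- For a *continuous* function, Huisken–Ilmanen's properness (`{s ≤ u ≤ t}` compact for all
`s, t`) is Mathlib's `IsProperMap` (preimages of compact sets are compact, Bourbaki): every
compact subset of `ℝ` lies in some `[s, t]`, and a closed subset of a compact set is compact.
[folklore] -/
theorem isProperFun_iff_isProperMap {u : X → ℝ} (hu : Continuous u) :
    IsProperFun u ↔ IsProperMap u := by
  rw [isProperMap_iff_isCompact_preimage]
  constructor
  · intro h
    refine ⟨hu, fun K hK ↦ ?_⟩
    exact (h (sInf K) (sSup K)).of_isClosed_subset (hK.isClosed.preimage hu)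
      (Set.preimage_mono hK.isBounded.subset_Icc_sInf_sSup)
  · rintro ⟨-, h⟩ s t
    exact h isCompact_Icc

/-- A **smooth precompact open set** `E₀ ⊆ X` (the initial conditions of Thm. 3.1: "nonempty,
precompact, smooth open set"): `E₀` is open with compact closure, regular open
(`interior (closure E₀) = E₀`, so that `E₀` lies locally on one side of its boundary), and its
topological boundary is a smoothly embedded compact surface (the image of a smooth embedding of a
compact Hausdorff `2`-manifold without boundary). Huisken–Ilmanen 2001, §3, Thm. 3.1 (and §1,
"an open set `E₀` with a boundary that is at least `C¹`"). [cite: HuiskenIlmanenIMCF2001, Thm. 3.1 hypotheses] -/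
def IsSmoothPrecompactOpen (E₀ : Set X) : Prop :=
  IsOpen E₀ ∧ IsCompact (closure E₀) ∧ interior (closure E₀) = E₀ ∧
    ∃ (S₀ : Type) (_ : TopologicalSpace S₀) (_ : ChartedSpace (EuclideanSpace ℝ (Fin 2)) S₀)
      (_ : IsManifold (𝓡 2) ∞ S₀) (_ : CompactSpace S₀) (_ : T2Space S₀) (φ : S₀ → X),
      Manifold.IsSmoothEmbedding (𝓡 2) (𝓡 3) ∞ φ ∧ range φ = frontier E₀

end Domains

/-- **Weak Existence Theorem** for the inverse mean curvature flow. Named fact: Huisken–Ilmanen,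
J. Differential Geom. 59 (2001), Thm. 3.1: *let `M` be a complete, connected Riemannian
`n`-manifold without boundary. Suppose there exists a proper, locally Lipschitz, weak subsolution
of (††) with a precompact initial condition. Then for any nonempty, precompact, smooth open set
`E₀` in `M`, there exists a proper, locally Lipschitz solution `u` of (††) with initial condition
`E₀`, which is unique on `M ∖ E₀`. Furthermore `|∇u(x)| ≤ sup_{∂E₀ ∩ B_r(x)} H₊ + C(n)/r` for
a.e. `x ∈ M ∖ E₀` and `0 < r ≤ σ(x)` (3.1).* Vendored for `n = 3` (manifolds modelled on `E3`,
boundaryless by construction), for *noncompact* `X` (the subsolution lives "at infinity", and the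
uniqueness invoked, Thm. 2.2, is stated under "`M` has no compact component"; an explicit
hypothesis here, which only weakens the fact), with completeness as geodesic completeness of the
Levi-Civita connection (`IsGeodesicallyComplete`, as in `InitialDataSet.IsComplete`), uniqueness
stated within the class of proper solutions (Thm. 2.2 (iii): uniqueness among solutions with
precompact `E_t`, which proper solutions have), and without the gradient estimate (3.1) (so the
fact is weaker than the printed theorem). The initial condition `F₀ = {v < 0}` of the assumed
subsolution is only required to be precompact, as printed in Thm. 3.1 and in the displayed
definition (††) (§1, "Initial Value Problem": `u ∈ C⁰'¹_loc(M)`, `E₀ = {u < 0}`, and `u`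
satisfies (1.5) in `M ∖ Ē₀`); the standing convention of §1 ("we will usually combine the above
definition with an initial condition consisting of an open set `E₀` with a boundary that is at
least `C¹`") is *not* imposed on `F₀`. Under a reading of the source that counts this convention
as part of the hypothesis of Thm. 3.1, omitting it admits more subsolutions, i.e. makes the
hypothesis formally weaker (and the implication formally stronger) than that reading; the printed
proof is insensitive to it: step 2 of the proof of Thm. 3.1 uses `v` only through the precompact
sublevel sets `F_L = {v < L}` (enclosed in smooth domains `U_L`) and through `min(v, L)` as a
comparison function in Thm. 2.2 (ii), never through the regularity of `∂F₀`. By Remark 1 after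
Thm. 3.1, asymptotically flat manifolds satisfying (0.1) possess the required subsolution
(`v = C log |x|` in the asymptotic region).
[cite: HuiskenIlmanenIMCF2001, Thm. 3.1 (and its proof, step 2)] -/
def weak_existence : Prop :=
  ∀ (X : Type) [TopologicalSpace X] [ChartedSpace E3 X] [IsManifold (𝓡 3) ∞ X] [T2Space X]
    [SecondCountableTopology X] [LocallyCompactSpace X] [ConnectedSpace X] [NoncompactSpace X]
    [MeasurableSpace X] [BorelSpace X]
    (h : ContMDiffRiemannianMetric (𝓡 3) ∞ E3 (TangentSpace (𝓡 3) : X → Type _))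
    [(ofRiemannian h).HasLeviCivita],
    IsGeodesicallyComplete (ofRiemannian h).leviCivita →
    (∃ (v : X → ℝ) (F₀ : Set X), IsProperFun v ∧ IsCompact (closure F₀) ∧
      IsWeakSubsolutionIVP h v F₀) →
    ∀ E₀ : Set X, E₀.Nonempty → IsSmoothPrecompactOpen E₀ →
      ∃ u : X → ℝ, IsProperFun u ∧ IsWeakSolutionIVP h u E₀ ∧
        ∀ u' : X → ℝ, IsProperFun u' → IsWeakSolutionIVP h u' E₀ → ∀ x ∉ E₀, u' x = u x


end Literature.Geometry.Lorentzian

end
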